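import Summits.Ventures.QEC.Thresholds.BBAnisotropicBounds
import Summits.Ventures.QEC.Theorems.BB90DistanceCertificateTarget
import Summits.Ventures.QEC.Theorems.BB108DistanceCertificateTarget
import Literature.InformationTheory.QuantumCodes.CSSPhenomenologicalDepolarizing
import HarnessLib

/-!
# Bivariate-bicycle census rows under PHENOMENOLOGICAL DEPOLARIZING noise (`T` rounds; three rates `p`, `q_X`, `q_Z`):
# the generic census interface `HasParams C n k d ⇒ P_fail ≤ 2·(3ℓmT)(14s)^d/(7(1-14s))`, and the rows `[[90,8,10]]`,
# `[[108,8,10]]` — UNCONDITIONAL, kernel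

Venture QEC, `Summits/Ventures/QEC/Thresholds/` (LADDER-QEC rung Q5 × Q2, PARTITION row 09 "noise models: depolarising;
phenomenological"; qec-type-09 gen 5, item 09.PHDEPOL; companion of `ToricCodePhenomenologicalDepolarizing.lean` and
`CSSFamilyPhenomenologicalDepolarizing.lean`, pattern of qec-type-09 gen 3's `BBDepolarizingCensus.lean`). For a bivariate-bicycle
code `C = QC(A, B)` with three distinct pure powers in `A` and in `B` (`IsBBPoly`: space-time check weight `6 + 2`), monitored
for `T` rounds under the three-rate law of `CSSPhenomenologicalDepolarizing.lean` (qubits depolarized at rate `p` per round,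
`X`-check record wrong at `q_X`, `Z`-check record at `q_Z`) and decoded SECTOR-WISE by ANY pair of minimum-weight space-time
decoders, the union bound `P_fail ≤ P^{Z,ph}(2p/3, q_X) + P^{X,ph}(2p/3, q_Z)` (`CSSCode.depolPhenomFailureProb_le`) and the
two-rate finite-size bounds `BB.zPhenomFailureProb_le_aniso` / `BB.xPhenomFailureProb_le_aniso` give, for every common rate
bound `2p/3, q_X, q_Z ≤ ρ ≤ 1/2` with `s := √(ρ(1-ρ))`, `14s < 1`:

* `bb_depolPhenomFailureProb_le_of_hasParams` — GENERIC census interface: `HasParams C n k d` (`d ≥ 1`) ⇒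
  `P_fail ≤ 2 · (3ℓmT)(14s)^d / (7(1 - 14s))`; every KERNEL census row `Summit.Ventures.QEC.Census.<id>.hasParams` feeds it.
* `bb90_depolPhenomFailureProb_le` — `[[90,8,10]]` (`BB90_8_10_claim_holds`, KERNEL): `≤ 2·135T(196ρ(1-ρ))⁵/(7(1-14s))`;
* `bb108_depolPhenomFailureProb_le` — `[[108,8,10]]` (`BB108_8_10_claim_holds`, KERNEL): `≤ 2·162T(196ρ(1-ρ))⁵/(7(1-14s))`.
  (`[[72,12,6]]`, `[[144,12,12]]`: `CSSFamilyPhenomenologicalDepolarizing.lean`.)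

HONEST FRAMING: rigorous UPPER bounds on failure (union bounds), kernel axioms, no named fact, no `native_decide`; sector-wise
(correlation-blind) minimum-weight space-time decoding (bivariate-bicycle sectors are not graphlike: the class is minimum-weight,
e.g. integer-programming decoding, not matching); not Monte Carlo pseudo-thresholds; circuit-level noise is not this model.

## References

* [DumerKovalevPryadko2015] I. Dumer, A. A. Kovalev, L. P. Pryadko, PRL 115 (2015) 050502, arXiv:1412.6172, Thm 3 with p. 5
  (w → w + 2) and eq. (succesful-decoding-depolarizing).
* [AliferisGottesmanPreskill2006] P. Aliferis, D. Gottesman, J. Preskill, QIC 6 (2006) 97, arXiv:quant-ph/0504218, §8.2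
  (chunk p0026 L11: the depolarizing channel, X, Y, Z equiprobable).
* [BravyiEtAl2024] S. Bravyi et al., Nature 627 (2024) 778, §4 (IsBBPoly side condition), Table 1 (`[[90,8,10]]`, `[[108,8,10]]`).
-/

noncomputable section

namespace Summit.Ventures.QEC.Thresholds

open Finset Matrix
open Literature.InformationTheory.QuantumCodes
open Summit.Ventures.QEC.BB Summit.Ventures.QEC.Census.BB90 Summit.Ventures.QEC.Census.BB108

/-- `(14s)^{2j} = (196 ρ(1-ρ))^j` for `s = √(ρ(1-ρ))`, `0 ≤ ρ ≤ 1`. [folklore] -/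
private theorem fourteen_sqrt_pow_two_mul' {ρ : ℝ} (hρ0 : 0 ≤ ρ) (hρ1 : ρ ≤ 1) (j : ℕ) :
    (14 * Real.sqrt (ρ * (1 - ρ))) ^ (2 * j) = (196 * (ρ * (1 - ρ))) ^ j := by
  rw [pow_mul, mul_pow, Real.sq_sqrt (mul_nonneg hρ0 (by linarith))]
  norm_num

/-- **Generic census interface, phenomenological depolarizing noise**: for every bivariate-bicycle code `C` with
`IsBBPoly` polynomials and census parameters `HasParams C n k d` (`d ≥ 1`), every `T`, every pair of minimum-weight
space-time decoders (`DZ` on the `X`-check record, `DX` on the `Z`-check record) and all rates with `2p/3, q_X, q_Z ≤ ρ ≤ 1/2`,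
`14√(ρ(1-ρ)) < 1`: `P_fail ≤ 2 · (3ℓmT) (14√(ρ(1-ρ)))^d / (7 (1 - 14√(ρ(1-ρ))))`. UNCONDITIONAL, kernel.
[cite: DumerKovalevPryadko2015, Thm 3 with p. 5 (w → w + 2) and eq. (succesful-decoding-depolarizing)]
[cite: AliferisGottesmanPreskill2006, §8.2 (chunk p0026 L11)] -/
theorem bb_depolPhenomFailureProb_le_of_hasParams {ℓ m : ℕ} [NeZero ℓ] [NeZero m] (C : BB.Code ℓ m)
    (hA : BB.IsBBPoly C.A) (hB : BB.IsBBPoly C.B) {n k d : ℕ} (h : HasParams C n k d) (hd1 : 1 ≤ d) (T : ℕ)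
    {DZ DX : CSSPhenom.STDecoder (BB.Mono ℓ m) (BB.Mono ℓ m ⊕ BB.Mono ℓ m) T}
    (hDZ : DZ.IsMinWeight (CSSPhenom.stSyn C.HX T) (CSSPhenom.stCycles C.HX T) hammingNorm)
    (hDX : DX.IsMinWeight (CSSPhenom.stSyn C.HZ T) (CSSPhenom.stCycles C.HZ T) hammingNorm)
    {p qX qZ ρ : ℝ} (hp0 : 0 ≤ p) (hpρ : 2 * p / 3 ≤ ρ) (hqX0 : 0 ≤ qX) (hqXρ : qX ≤ ρ) (hqZ0 : 0 ≤ qZ)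
    (hqZρ : qZ ≤ ρ) (hρ : ρ ≤ 1 / 2) (hr : 14 * Real.sqrt (ρ * (1 - ρ)) < 1) :
    C.css.depolPhenomFailureProb T DZ DX p qX qZ ≤
      2 * ((3 * ℓ * m * T : ℕ) * (14 * Real.sqrt (ρ * (1 - ρ))) ^ d / (7 * (1 - 14 * Real.sqrt (ρ * (1 - ρ))))) := by
  obtain ⟨-, -, hd⟩ := h
  have hd1' : 1 ≤ C.d := by rw [hd]; exact hd1
  have hq0 : 0 ≤ 2 * p / 3 := by positivity
  have hZ := BB.zPhenomFailureProb_le_aniso C hA hB T hDZ hd1' hq0 hqX0 hpρ hqXρ hρ hr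
  have hX := BB.xPhenomFailureProb_le_aniso C hA hB T hDX hd1' hq0 hqZ0 hpρ hqZρ hρ hr
  rw [hd] at hZ hX
  have h0 := C.css.depolPhenomFailureProb_le T DZ DX hp0 (by linarith) hqX0 (by linarith) hqZ0 (by linarith)
  rw [BB.Code.css_HX, BB.Code.css_HZ] at h0
  linarith

/-- **`[[90,8,10]]` under phenomenological depolarizing noise** (`T` rounds; `2p/3, q_X, q_Z ≤ ρ ≤ 1/2`, `14√(ρ(1-ρ)) < 1`),
ANY pair of minimum-weight space-time decoders: `P_fail ≤ 2 · 135T (196ρ(1-ρ))⁵ / (7(1 - 14√(ρ(1-ρ))))`. UNCONDITIONAL,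
kernel (`BB90_8_10_claim_holds`). [cite: DumerKovalevPryadko2015, Thm 3 with p. 5] [cite: BravyiEtAl2024, Table 1 ([[90,8,10]])] -/
theorem bb90_depolPhenomFailureProb_le (T : ℕ)
    {DZ DX : CSSPhenom.STDecoder (BB.Mono 15 3) (BB.Mono 15 3 ⊕ BB.Mono 15 3) T}
    (hDZ : DZ.IsMinWeight (CSSPhenom.stSyn BB.bb90.HX T) (CSSPhenom.stCycles BB.bb90.HX T) hammingNorm)
    (hDX : DX.IsMinWeight (CSSPhenom.stSyn BB.bb90.HZ T) (CSSPhenom.stCycles BB.bb90.HZ T) hammingNorm)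
    {p qX qZ ρ : ℝ} (hp0 : 0 ≤ p) (hpρ : 2 * p / 3 ≤ ρ) (hqX0 : 0 ≤ qX) (hqXρ : qX ≤ ρ) (hqZ0 : 0 ≤ qZ)
    (hqZρ : qZ ≤ ρ) (hρ : ρ ≤ 1 / 2) (hr : 14 * Real.sqrt (ρ * (1 - ρ)) < 1) :
    BB.bb90.css.depolPhenomFailureProb T DZ DX p qX qZ ≤
      2 * (135 * T * (196 * (ρ * (1 - ρ))) ^ 5 / (7 * (1 - 14 * Real.sqrt (ρ * (1 - ρ))))) := by
  have h := bb_depolPhenomFailureProb_le_of_hasParams BB.bb90 BB.isBBPoly_bb90.1 BB.isBBPoly_bb90.2 BB90_8_10_claim_holds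
    (by norm_num) T hDZ hDX hp0 hpρ hqX0 hqXρ hqZ0 hqZρ hρ hr
  have hpow : (14 * Real.sqrt (ρ * (1 - ρ))) ^ 10 = (196 * (ρ * (1 - ρ))) ^ 5 :=
    fourteen_sqrt_pow_two_mul' (by linarith) (by linarith) 5
  rw [hpow] at h
  convert h using 3
  push_cast
  ring

/-- **`[[108,8,10]]` under phenomenological depolarizing noise**, ANY pair of minimum-weight space-time decoders:
`P_fail ≤ 2 · 162T (196ρ(1-ρ))⁵ / (7(1 - 14√(ρ(1-ρ))))`. UNCONDITIONAL, kernel (`BB108_8_10_claim_holds`).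
[cite: DumerKovalevPryadko2015, Thm 3 with p. 5] [cite: BravyiEtAl2024, Table 1 ([[108,8,10]])] -/
theorem bb108_depolPhenomFailureProb_le (T : ℕ)
    {DZ DX : CSSPhenom.STDecoder (BB.Mono 9 6) (BB.Mono 9 6 ⊕ BB.Mono 9 6) T}
    (hDZ : DZ.IsMinWeight (CSSPhenom.stSyn BB.bb108.HX T) (CSSPhenom.stCycles BB.bb108.HX T) hammingNorm)
    (hDX : DX.IsMinWeight (CSSPhenom.stSyn BB.bb108.HZ T) (CSSPhenom.stCycles BB.bb108.HZ T) hammingNorm)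
    {p qX qZ ρ : ℝ} (hp0 : 0 ≤ p) (hpρ : 2 * p / 3 ≤ ρ) (hqX0 : 0 ≤ qX) (hqXρ : qX ≤ ρ) (hqZ0 : 0 ≤ qZ)
    (hqZρ : qZ ≤ ρ) (hρ : ρ ≤ 1 / 2) (hr : 14 * Real.sqrt (ρ * (1 - ρ)) < 1) :
    BB.bb108.css.depolPhenomFailureProb T DZ DX p qX qZ ≤
      2 * (162 * T * (196 * (ρ * (1 - ρ))) ^ 5 / (7 * (1 - 14 * Real.sqrt (ρ * (1 - ρ))))) := by
  have h := bb_depolPhenomFailureProb_le_of_hasParams BB.bb108 BB.isBBPoly_bb108.1 BB.isBBPoly_bb108.2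
    BB108_8_10_claim_holds (by norm_num) T hDZ hDX hp0 hpρ hqX0 hqXρ hqZ0 hqZρ hρ hr
  have hpow : (14 * Real.sqrt (ρ * (1 - ρ))) ^ 10 = (196 * (ρ * (1 - ρ))) ^ 5 :=
    fourteen_sqrt_pow_two_mul' (by linarith) (by linarith) 5
  rw [hpow] at h
  convert h using 3
  push_cast
  ring

end Summit.Ventures.QEC.Thresholds

end
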